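import Summits.AtomisticToContinuum.BoseEinsteinCondensation.Theses.BECInsertionCorrector
import Summits.AtomisticToContinuum.BoseEinsteinCondensation.Theorems.BECInsertionCorrectorResidueCondenses
import Summits.AtomisticToContinuum.BoseEinsteinCondensation.Theorems.BECInsertionCorrectorCorrectorClosureSplit
import HarnessLib

/-!
# Strategist census S9 (independent, family `s`) — typed exhibits for
# `BECInsertionCorrector.CorrectorClosure` (item stmt-AtomisticToContinuum-12058)

Exhibits referenced by `Cruxes/CorrectorClosure/STRATEGY-CENSUS-s9.md`:

* §1 WEAKER INTERMEDIATE. `WeakCorrectorClosure := StaticResponseBound → ∀ v adm, PeriodicBEC-body v`.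
  `weakCorrectorClosure_of_correctorClosure` (the crux implies it, via the landed
  `ResidueCondenses_proof`) and `closes_of_weakCorrectorClosure` (it can replace the crux in the
  route's deciding theorem verbatim, making `ResidueCondenses` idle). So the load-bearing content of
  the crux inside `closes` is exactly `K1 ⇒ torus BEC (item 8997) for every admissible v`; the
  removal-fidelity surplus `InsertionResidueOfBEC` is NOT consumed by `closes`.
* §1' Given K1 the weak form is literally item 8997 (`weak_iff_periodicBEC_of_K1`).
* §4 STRENGTHEN. `InsertionResidueWithRate` (Bogoliubov-rate form `Z ≥ 1 − C√(ρ a³)`), typed only.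

Pure logic over landed theorems; sorry-free. [folklore]
-/

noncomputable section

open MeasureTheory Filter Matrix
open scoped ENNReal NNReal BigOperators ComplexConjugate

namespace Summit.AtomisticToContinuum.BoseEinsteinCondensation.Cruxes.CorrectorClosure.CensusS9

open Literature.MathematicalPhysics.QuantumManyBody.BoseGas
open Summit.AtomisticToContinuum.BoseEinsteinCondensation.Theses.BECInsertionCorrector

/-- Torus BEC of near-minimisers at ONE potential: verbatim the body of item
stmt-AtomisticToContinuum-8997 `PeriodicBEC` (and of the hypothesis `BoundaryTransferWeak` consumes). -/
def PeriodicBECAt (v : ℝ → ℝ≥0∞) : Prop :=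
  ∃ ρ₀ : ℝ, 0 < ρ₀ ∧ ∀ ρ : ℝ, 0 < ρ → ρ < ρ₀ → ∃ c : ℝ, 0 < c ∧ ∀ᶠ N : ℕ in Filter.atTop,
    ∃ δ : ℝ≥0∞, 0 < δ ∧ ∀ Ψ : PeriodicTrialState N (sideLength ρ N),
      periodicEnergy v Ψ ≤ periodicGroundStateEnergy v N (sideLength ρ N) + δ →
      ENNReal.ofReal (c * N) ≤ condensateOccupation N (sideLength ρ N) Ψ.ψ

/-- §1 The weakest statement that can stand in for the crux inside `closes`:
`K1 ⇒ torus BEC for every admissible v`. -/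
def WeakCorrectorClosure : Prop :=
  StaticResponseBound → ∀ v : ℝ → ℝ≥0∞, IsRepulsiveFiniteRange v → PeriodicBECAt v

/-- The crux implies the weak form (landed necessity `ResidueCondenses_proof`, item 12059). -/
theorem weakCorrectorClosure_of_correctorClosure (hCC : CorrectorClosure) : WeakCorrectorClosure :=
  fun hK1 v hv =>
    Summit.AtomisticToContinuum.BoseEinsteinCondensation.Theorems.ResidueCondenses_proof (hCC hK1) v hv

/-- The weak form replaces the crux in the route's deciding theorem VERBATIM (same term shape as
`BECInsertionCorrector.closes`, with `ResidueCondenses` no longer needed). -/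
theorem closes_of_weakCorrectorClosure (h₁ : StaticResponseBound) (hW : WeakCorrectorClosure)
    (h₄ : BoundaryTransferWeak) : _root_.BoseEinsteinCondensation :=
  fun v hv => h₄ v hv (hW h₁ v hv)

/-- §1' Given K1 (the route's own rank-2 crux), the weak form is literally item 8997
(torus BEC for every admissible `v`): the antecedent discharges. -/
theorem weak_iff_periodicBEC_of_K1 (hK1 : StaticResponseBound) :
    WeakCorrectorClosure ↔ ∀ v : ℝ → ℝ≥0∞, IsRepulsiveFiniteRange v → PeriodicBECAt v :=
  ⟨fun hW => hW hK1, fun hP _ => hP⟩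

/-- §2 The crux given K1 is EXACTLY (item 8997) ∧ (BEC-conditional removal fidelity): restated from the
landed `correctorClosure_iff_of_staticResponseBound` (p169803) in the present vocabulary. -/
theorem correctorClosure_iff_periodicBEC_and_residueOfBEC (hK1 : StaticResponseBound) :
    CorrectorClosure ↔
      ((∀ v : ℝ → ℝ≥0∞, IsRepulsiveFiniteRange v → PeriodicBECAt v) ∧
       (StaticResponseBound → ∀ v : ℝ → ℝ≥0∞, IsRepulsiveFiniteRange v → PeriodicBECAt v →
        ∃ ρ₀ : ℝ, 0 < ρ₀ ∧ ∀ ρ : ℝ, 0 < ρ → ρ < ρ₀ → ∃ c : ℝ, 0 < c ∧ ∀ᶠ N : ℕ in Filter.atTop,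
          ∃ δ : ℝ≥0∞, 0 < δ ∧ ∃ Θ : PeriodicTrialState N (sideLength ρ (N + 1)),
            periodicEnergy v Θ ≤ periodicGroundStateEnergy v N (sideLength ρ (N + 1)) + δ ∧
            ∀ Ψ : PeriodicTrialState (N + 1) (sideLength ρ (N + 1)),
              periodicEnergy v Ψ ≤ periodicGroundStateEnergy v (N + 1) (sideLength ρ (N + 1)) + δ →
              ENNReal.ofReal c ≤ ENNReal.ofReal ((sideLength ρ (N + 1) ^ 3)⁻¹) *
                (‖∫ X in cellN N (sideLength ρ (N + 1)), conj (Θ.ψ X) *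
                    ∫ x in cell (sideLength ρ (N + 1)), Ψ.ψ (vecCons x X)‖₊ : ℝ≥0∞) ^ 2)) :=
  Summit.AtomisticToContinuum.BoseEinsteinCondensation.Theorems.CorrectorClosure.Split.correctorClosure_iff_of_staticResponseBound
    hK1

/-- §4 STRENGTHEN (typed only): the insertion residue with the Bogoliubov rate
`Z_N ≥ 1 − C √(ρ a³)` (`a` = scattering length), uniformly in large `N`. Strictly stronger than
`InsertionResidue` for small `ρ`; see the census for why the added rigidity buys nothing here. -/
def InsertionResidueWithRate : Prop :=
  ∀ v : ℝ → ℝ≥0∞, IsRepulsiveFiniteRange v → ∃ C : ℝ, 0 < C ∧ ∃ ρ₀ : ℝ, 0 < ρ₀ ∧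
    ∀ ρ : ℝ, 0 < ρ → ρ < ρ₀ → ∀ᶠ N : ℕ in Filter.atTop,
      ∃ δ : ℝ≥0∞, 0 < δ ∧ ∃ Θ : PeriodicTrialState N (sideLength ρ (N + 1)),
        periodicEnergy v Θ ≤ periodicGroundStateEnergy v N (sideLength ρ (N + 1)) + δ ∧
        ∀ Ψ : PeriodicTrialState (N + 1) (sideLength ρ (N + 1)),
          periodicEnergy v Ψ ≤ periodicGroundStateEnergy v (N + 1) (sideLength ρ (N + 1)) + δ →
          ENNReal.ofReal (1 - C * Real.sqrt (ρ * (scatteringLength v).toReal ^ 3)) ≤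
            ENNReal.ofReal ((sideLength ρ (N + 1) ^ 3)⁻¹) *
              (‖∫ X in cellN N (sideLength ρ (N + 1)), conj (Θ.ψ X) *
                  ∫ x in cell (sideLength ρ (N + 1)), Ψ.ψ (vecCons x X)‖₊ : ℝ≥0∞) ^ 2

/-- The strengthened crux `K1 → InsertionResidueWithRate`. -/
def CorrectorClosureWithRate : Prop :=
  StaticResponseBound → InsertionResidueWithRate

end Summit.AtomisticToContinuum.BoseEinsteinCondensation.Cruxes.CorrectorClosure.CensusS9

end
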